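import Mathlib
import Literature.NumberTheory.Transcendental.KZCubicalCalculus
import Literature.NumberTheory.Transcendental.SemialgebraicMaps
import Literature.ModelTheory.ExponentialFields.SemialgebraicInterior
import Literature.NumberTheory.Transcendental.KZIntervalPeriodProofs

/-!
# Crux `TateFamilyKernel` (stmt-KontsevichZagierPeriods-9130), line `Sketch` — `stub_covMonotoneFirstCoord`
# (wave 16 seed, lead c4: rule (2) along a monotone polynomial in the first coordinate of the square)

For the corner case `T(1,0) = T(0,1)` of the Euler sector the two face bands are carried onto the SAME
`(u,t)`-square by the changes of variables `u = ν_a(s)`, `u = ν_b(s)` with `ν` the normalised (increasing,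
`ν(0) = 0`, `ν(1) = 1`) face restriction of the pencil. This file provides that move as an instance of the
cubical change-of-variables generator (`KZ.cubicalCovGens`): for tame cubes `r, r'` on `[0,1]²` with
`r(x) = r'(ν(x₀), x₁)·|ν'(x₀)|`, `[r] − [r'] ∈ KZ.relations`. Ingredients: the self-map
`Φ(x) = (ν(x₀), x₁)` of the square is `ℚ`-semialgebraic with analytic (polynomial) coordinates, injective
(strict monotonicity) and onto (intermediate value theorem), with derivative `diag(ν'(x₀), 1)` of
determinant `ν'(x₀)`. Mathlib + the cubical calculus; no named fact, no new definition.
-/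

noncomputable section

open MeasureTheory Set MvPolynomial
open Literature.NumberTheory.Transcendental

namespace Summit.KontsevichZagierPeriods.InverseLandau.TateFamilyKernel.Descent

namespace CovMonotone

/-- The first coordinate `x ↦ ν(x₀)` as a two-variable polynomial function. [folklore] -/
theorem aeval_first (ν : Polynomial ℚ) (x : Fin 2 → ℝ) :
    aeval x (Polynomial.aeval (X 0 : MvPolynomial (Fin 2) ℚ) ν) = Polynomial.aeval (x 0) ν := by
  rw [← Polynomial.aeval_algHom_apply, aeval_X]

/-- The derivative of the self-map `Φ(x) = (ν(x₀), x₁)`: the continuous linear map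
`v ↦ (ν'(x₀)v₀, v₁)`. [folklore] -/
theorem hasFDerivAt_phi (ν : Polynomial ℚ) (x : Fin 2 → ℝ) :
    HasFDerivAt (fun y : Fin 2 → ℝ => (![Polynomial.aeval (y 0) ν, y 1] : Fin 2 → ℝ))
      (ContinuousLinearMap.pi
        (![Polynomial.aeval (x 0) (Polynomial.derivative ν) • ContinuousLinearMap.proj 0,
          ContinuousLinearMap.proj 1] : Fin 2 → ((Fin 2 → ℝ) →L[ℝ] ℝ))) x := by
  rw [hasFDerivAt_pi']
  intro i
  rw [ContinuousLinearMap.proj_pi]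
  fin_cases i
  · simp only [Fin.zero_eta, Matrix.cons_val_zero]
    have h1 : HasFDerivAt (fun y : Fin 2 → ℝ => y 0) (ContinuousLinearMap.proj (R := ℝ) (φ := fun _ : Fin 2 => ℝ) 0) x :=
      hasFDerivAt_apply 0 x
    have h2 : HasDerivAt (fun s : ℝ => Polynomial.aeval s ν) (Polynomial.aeval (x 0) (Polynomial.derivative ν)) (x 0) :=
      ν.hasDerivAt_aeval (x 0)
    exact h2.comp_hasFDerivAt x h1
  · simp only [Fin.mk_one, Matrix.cons_val_one, Matrix.cons_val_fin_one]
    exact hasFDerivAt_apply 1 x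

/-- The determinant of `v ↦ (c·v₀, v₁)` is `c`. [folklore] -/
theorem det_pi_diag (c : ℝ) :
    (ContinuousLinearMap.pi
        (![c • ContinuousLinearMap.proj 0, ContinuousLinearMap.proj 1] :
          Fin 2 → ((Fin 2 → ℝ) →L[ℝ] ℝ))).det = c := by
  rw [ContinuousLinearMap.det, ← LinearMap.det_toMatrix']
  have hM : LinearMap.toMatrix'
      ((ContinuousLinearMap.pi
        (![c • ContinuousLinearMap.proj 0, ContinuousLinearMap.proj 1] :
          Fin 2 → ((Fin 2 → ℝ) →L[ℝ] ℝ))) : (Fin 2 → ℝ) →ₗ[ℝ] (Fin 2 → ℝ)) = !![c, 0; 0, 1] := by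
    ext i j
    rw [LinearMap.toMatrix'_apply]
    fin_cases i <;> fin_cases j <;> simp
  rw [hM, Matrix.det_fin_two_of]
  ring

end CovMonotone

/-- **Rule (2) along a monotone polynomial in the first coordinate** (wave 16 seed of the lead's skeleton):
for `ν ∈ ℚ[s]` strictly increasing on `[0,1]` with `ν(0) = 0`, `ν(1) = 1`, and tame cubes `r, r'` on `[0,1]²`
with `r(x) = r'(ν(x₀), x₁)·|ν'(x₀)|`, the element `[r] − [r']` is a KZ relation (change of variables
`Φ(x) = (ν(x₀), x₁)`, a semialgebraic analytic bijection of the square). [cite: KontsevichZagier2001, §1.2 rule (2)] -/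
theorem stub_covMonotoneFirstCoord (ν : Polynomial ℚ) (hν0 : Polynomial.aeval (0 : ℝ) ν = 0)
    (hν1 : Polynomial.aeval (1 : ℝ) ν = 1) (hmono : StrictMonoOn (fun s : ℝ => Polynomial.aeval s ν) (Icc 0 1))
    (r r' : KZ.IntegralRep 2) (hr : r.IsTameCube) (hr' : r'.IsTameCube)
    (hf : ∀ x ∈ KZ.cube 2, r.integrand x =
      r'.integrand (![Polynomial.aeval (x 0) ν, x 1] : Fin 2 → ℝ) *
        |Polynomial.aeval (x 0) (Polynomial.derivative ν)|) :
    KZ.of r - KZ.of r' ∈ KZ.relations := by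
  have hmonot : MonotoneOn (fun s : ℝ => Polynomial.aeval s ν) (Icc 0 1) := hmono.monotoneOn
  -- the self-map and its properties
  have hmem : ∀ x ∈ KZ.cube 2, (![Polynomial.aeval (x 0) ν, x 1] : Fin 2 → ℝ) ∈ KZ.cube 2 := by
    intro x hx
    have h0 := KZ.mem_cube.1 hx 0
    have h1 := KZ.mem_cube.1 hx 1
    refine KZ.mem_cube.2 fun i => ?_
    fin_cases i
    · refine ⟨?_, ?_⟩
      · have := hmonot (left_mem_Icc.2 zero_le_one) h0 h0.1
        simpa [hν0] using this
      · have := hmonot h0 (right_mem_Icc.2 zero_le_one) h0.2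
        simpa [hν1] using this
    · simpa using h1
  have hΦs : IsSemialgebraicMapOn ℚ (KZ.cube 2)
      (fun x : Fin 2 → ℝ => (![Polynomial.aeval (x 0) ν, x 1] : Fin 2 → ℝ)) := by
    refine IsSemialgebraicMapOn.of_forall KZ.isSemialgebraic_cube fun j => ?_
    fin_cases j
    · simp only [Fin.zero_eta, Matrix.cons_val_zero]
      have := isSemialgebraicFunOn_aeval (R := ℝ) KZ.isSemialgebraic_cube
        (Polynomial.aeval (X 0 : MvPolynomial (Fin 2) ℚ) ν)
      simpa only [CovMonotone.aeval_first] using this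
    · simp only [Fin.mk_one, Matrix.cons_val_one, Matrix.cons_val_fin_one]
      exact isSemialgebraicFunOn_apply KZ.isSemialgebraic_cube 1
  have hinj : InjOn (fun x : Fin 2 → ℝ => (![Polynomial.aeval (x 0) ν, x 1] : Fin 2 → ℝ)) (KZ.cube 2) := by
    intro x hx y hy hxy
    have h0 : Polynomial.aeval (x 0) ν = Polynomial.aeval (y 0) ν := by
      have := congrFun hxy 0; simpa using this
    have h1 : x 1 = y 1 := by
      have := congrFun hxy 1; simpa using this
    have hx0 : x 0 = y 0 := hmono.injOn (KZ.mem_cube.1 hx 0) (KZ.mem_cube.1 hy 0) h0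
    funext i
    fin_cases i
    · exact hx0
    · exact h1
  have himg : (fun x : Fin 2 → ℝ => (![Polynomial.aeval (x 0) ν, x 1] : Fin 2 → ℝ)) '' KZ.cube 2 = KZ.cube 2 := by
    refine Subset.antisymm ?_ ?_
    · rintro _ ⟨x, hx, rfl⟩
      exact hmem x hx
    · intro y hy
      have hy0 := KZ.mem_cube.1 hy 0
      have hy1 := KZ.mem_cube.1 hy 1
      -- intermediate value theorem for the continuous `ν` on `[0,1]`
      have hcont : ContinuousOn (fun s : ℝ => Polynomial.aeval s ν) (Icc 0 1) :=
        (Polynomial.continuous_aeval ν).continuousOn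
      have hivt := intermediate_value_Icc zero_le_one hcont
      rw [hν0, hν1] at hivt
      obtain ⟨s, hs, hsy⟩ := hivt ⟨hy0.1, hy0.2⟩
      refine ⟨![s, y 1], KZ.mem_cube.2 fun i => ?_, ?_⟩
      · fin_cases i
        · simpa using hs
        · simpa using hy1
      · funext i
        fin_cases i
        · simpa using hsy
        · simp
  have hΦa : ∀ i : Fin 2, AnalyticOnNhd ℝ
      (fun x : Fin 2 → ℝ => (![Polynomial.aeval (x 0) ν, x 1] : Fin 2 → ℝ) i) (KZ.cube 2) := by
    intro i
    fin_cases i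
    · simp only [Fin.zero_eta, Matrix.cons_val_zero]
      have := (Literature.ModelTheory.ExponentialFields.analyticOnNhd_aeval (k := ℚ)
        (Polynomial.aeval (X 0 : MvPolynomial (Fin 2) ℚ) ν)).mono (subset_univ (KZ.cube 2))
      simpa only [CovMonotone.aeval_first] using this
    · simp only [Fin.mk_one, Matrix.cons_val_one, Matrix.cons_val_fin_one]
      exact ((ContinuousLinearMap.proj (R := ℝ) (φ := fun _ : Fin 2 => ℝ) 1).analyticOnNhd _).mono
        (subset_univ _)
  refine KZ.cubicalCovGens_subset_relations (KZ.mem_cubicalCovGens hr hr' hΦs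
    (fun x _ => (CovMonotone.hasFDerivAt_phi ν x).hasFDerivWithinAt) hinj himg hΦa fun x hx => ?_)
  rw [hf x hx, CovMonotone.det_pi_diag]

end Summit.KontsevichZagierPeriods.InverseLandau.TateFamilyKernel.Descent

end
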